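import Literature.Analysis.FluidPDE.TaoClassGlue
import Literature.Analysis.FluidPDE.LerayEnstrophyAPriori
import HarnessLib

/-!
# Route `GaldiLiouvilleGate`, crux `RecordZoomAncient` (stmt-NavierStokesRegularity-0894),
  line `registered` (birth skeleton, reshape r2) — stub `stub_enstrophyPersistence`
  (enstrophy a priori bound with lifespan)

**Statement.** There are absolute constants `c > 0`, `K ≥ 1` such that for every classical
solution `(u, p)` of the unforced Navier–Stokes system (viscosity `ν > 0`) on `ℝ³ × [0, T)`
which is a solution in Tao's smooth `H¹` class on every closed sub-slab `[0, T']`, `0 < T' < T`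
(`IsTaoSolutionOn T' ν (u 0) u P` for some pressure `P`): if the enstrophy at time
`t₀ ∈ [0, T)` is at most `L > 0`, `∫ |∇u(t₀)|² ≤ L`, then `∫ |∇u(t)|² ≤ K L` for all
`t ∈ [t₀, T)` with `t - t₀ ≤ c ν³ / L²`.

**Proof.** This is the enstrophy a priori bound with lifespan of Robinson–Rodrigo–Sadowski 2016,
Thm. 6.8 / Cor. 6.9, proved in the tree as `exists_leray_enstrophy_apriori`
(`LerayEnstrophyAPriori.lean`), restarted at time `t₀`: for `t₀ < t < T` put `T' := (t + T)/2`,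
take the Tao-class representation on `[0, T']`, translate it by `t₀`
(`IsTaoSolutionOn.translate`) and restrict it to `[0, t - t₀]` (`IsTaoSolutionOn.mono`); its
fields are exactly the hypotheses of `exists_leray_enstrophy_apriori` with `A := L` on the slab
`[0, t - t₀]`, and `L² (t - t₀) ≤ c ν³`. The case `t = t₀` is the hypothesis (`K ≥ 1`).

Sources: J. C. Robinson, J. L. Rodrigo, W. Sadowski, *The Three-Dimensional Navier–Stokes
Equations* (CUP 2016), Thm. 6.8, Cor. 6.9; T. Tao, *Localisation and compactness properties of
the Navier–Stokes global regularity problem*, Anal. PDE 6 (2013), Thm. 5.4 (ii).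
-/

noncomputable section

open Set MeasureTheory Filter Topology Function
open scoped ENNReal NNReal
open Literature.Analysis.FluidPDE

namespace Summit.NavierStokesRegularity.NavierStokesRegularity.Theorems.RecordZoomAncient.Birth

-- the problem-side namespace `Summit.NavierStokesRegularity.NavierStokesRegularity.…` (summit =
-- problem for this single-problem summit) duplicates `NavierStokesRegularity` by design
set_option linter.dupNamespace false

/-- **stub — `stub_enstrophyPersistence` (enstrophy a priori bound with lifespan,
Robinson–Rodrigo–Sadowski 2016, Thm. 6.8 / Cor. 6.9).** There are absolute constants `c > 0`,
`K ≥ 1` such that for every classical solution of the unforced Navier–Stokes system on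
`ℝ³ × [0, T)` which is Tao-class on every closed sub-slab `[0, T']`, `0 < T' < T`: if
`∫ |∇u(t₀)|² ≤ L` (`0 ≤ t₀ < T`, `L > 0`) then `∫ |∇u(t)|² ≤ K L` for all `t ∈ [t₀, T)` with
`t - t₀ ≤ c ν³ / L²`. Proof: restart the Tao-class representation on `[0, (t + T)/2]` at `t₀`
(`IsTaoSolutionOn.translate`, `IsTaoSolutionOn.mono`) and apply the tree theorem
`exists_leray_enstrophy_apriori` on the slab `[0, t - t₀]` with `A := L`. -/
theorem stub_enstrophyPersistence :
    ∃ c K : ℝ, 0 < c ∧ 1 ≤ K ∧ ∀ (ν T : ℝ), 0 < ν → 0 < T →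
      ∀ (u : ℝ → EuclideanSpace ℝ (Fin 3) → EuclideanSpace ℝ (Fin 3))
        (p : ℝ → EuclideanSpace ℝ (Fin 3) → ℝ),
        IsClassicalNSSolutionOn (Set.Ico 0 T) ν 0 u p →
        (∀ T' ∈ Set.Ioo 0 T, ∃ P : ℝ → EuclideanSpace ℝ (Fin 3) → ℝ,
          IsTaoSolutionOn T' ν (u 0) u P) →
        ∀ t₀ ∈ Set.Ico 0 T, ∀ L : ℝ, 0 < L →
          (∫⁻ x, ENNReal.ofReal (frobeniusNormSq (fderiv ℝ (u t₀) x))) ≤ ENNReal.ofReal L →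
          ∀ t ∈ Set.Ico t₀ T, t - t₀ ≤ c * ν ^ 3 / L ^ 2 →
            (∫⁻ x, ENNReal.ofReal (frobeniusNormSq (fderiv ℝ (u t) x))) ≤
              ENNReal.ofReal (K * L) := by
  obtain ⟨c, K, hc, _hK, h⟩ := exists_leray_enstrophy_apriori
  refine ⟨c, max K 1, hc, le_max_right K 1, ?_⟩
  intro ν T hν _hT u _p _hsol hrep t₀ ht₀ L hL hE t ht hdt
  rcases eq_or_lt_of_le ht.1 with heq | hlt
  · -- `t = t₀`: the hypothesis, `K ≥ 1`
    subst heq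
    exact hE.trans (ENNReal.ofReal_le_ofReal (le_mul_of_one_le_left hL.le (le_max_right K 1)))
  · -- `t₀ < t < T`: restart at `t₀` on the closed slab `[0, (t + T)/2]`
    obtain ⟨P, hP⟩ := hrep ((t + T) / 2) ⟨by linarith [ht₀.1, ht.2], by linarith [ht.2]⟩
    have h1 : IsTaoSolutionOn ((t + T) / 2 - t₀) ν (u t₀) (fun s => u (s + t₀))
        (fun s => P (s + t₀)) :=
      hP.translate ht₀.1 (by linarith [ht.2])
    have h2 : IsTaoSolutionOn (t - t₀) ν (u t₀) (fun s => u (s + t₀)) (fun s => P (s + t₀)) :=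
      h1.mono (sub_pos.2 hlt) (by linarith [ht.2])
    have hdatum : (∫⁻ x, ENNReal.ofReal (frobeniusNormSq
        (fderiv ℝ ((fun s => u (s + t₀)) 0) x))) ≤ ENNReal.ofReal L := by
      simpa only [zero_add] using hE
    have hsmall : L ^ 2 * (t - t₀) ≤ c * ν ^ 3 := by
      have hL2 : 0 < L ^ 2 := by positivity
      rw [mul_comm]
      exact (le_div_iff₀ hL2).1 hdt
    obtain ⟨hbound, -⟩ := h hν (sub_pos.2 hlt) h2.classical h2.sobolev h2.sobolev_dt
      h2.sobolev_p hL.le hdatum hsmall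
    have h3 := hbound (t - t₀) ⟨(sub_pos.2 hlt).le, le_rfl⟩
    simp only [sub_add_cancel] at h3
    exact h3.trans (ENNReal.ofReal_le_ofReal (mul_le_mul_of_nonneg_right (le_max_left K 1) hL.le))

end Summit.NavierStokesRegularity.NavierStokesRegularity.Theorems.RecordZoomAncient.Birth

end
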